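import Literature.Computability.AlgebraicComplexity.BLMW11PaddedPerSlice
import Literature.Computability.AlgebraicComplexity.BLMW11PerSliceCharacterProofs
import Literature.RepresentationTheory.FiniteGroups.SymmetricGroupPieriRule
import HarnessLib

/-!
# BLMW 2011, Prop. 5.6.2 (5.6.2) — the orbit closure of the padded permanent:
# `BLMW2011_prop_5_6_2_closure_holds` (proof, part 2: stabilizer check and assembly)

P. Bürgisser, J. M. Landsberg, L. Manivel, J. Weyman, SIAM J. Comput. 40 (2011) =
arXiv:0907.2850, §5.6, Prop. 5.6.2 (5.6.2): "`ℂ[\overline{GL(W)·ℓ^{n-m}per_m}]_δ ⊆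
⊕_{π ∈ Σ^n_{per_m}, |π| = nδ} (S_πW^*)^{⊕ mult^n_π}`", `mult^n_π = ∑_{π' ∈ Σ_{per_m}, π ↦ π'} mult_{π'}`
(Def. 5.6.1) — "Proposition 5.5.2 and Example 5.4 show" it. Cell `val-lit` (D-0074 GROUP L), row
BLMW11-A: this file DISCHARGES the named fact `BLMW2011_prop_5_6_2_closure` of
`BLMW11StabilityInheritance.lean` (in its AS-PROVED reading: corrected `mult_{π'}` = `BLMW2011.multPer`,
degree guard `0 < δ`, ERRATA A12/A19 recorded there), following the printed argument:

1. **(5.6.1), the stabilizer** — every element of the family `PadPer.IsPadPerStab` (the per-stabilizer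
   family of the block extended by the identity, the balance torus `(ξ, η) = (2^{n-m}, 2^{-m})` with
   `η^{n-m}ξ^m = 1`, the kill torus on `B`) fixes `x₀₀^{n-m} per_m`
   (`linSubstRep_reindexGL_paddedPerFormLex_of_isPadPerStab`; the polynomial identity
   `paddedPerFormLex k m n = x₀₀^{n-m} · ι(per_m)`, `paddedPerFormLex_eq_X_pow_mul_rename`).
2. **(4.1.2)/§5.2, multiplicities are bounded by invariant dimensions** —
   `mult_{π*} ℂ[Δ(x₀₀^{n-m}per_m)] ≤ dim T`, `T` the bound space of `𝔖_{nδ}`-invariant coefficient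
   matrices with rows in the fixed space `padInvariants` (the tree's
   `finrank_highestWeightSpace_orbitCoordRep_le`), and `(nδ)! · dim T = ∑_τ χ^π(τ) χ_X(τ)`
   (`card_mul_finrank_boundSpace`).
3. **Pieri (Prop. 4.5.4 / Example 5.4)** — `χ_X` is the character of `⊕_{|S| = (n-m)δ} E_S(X_per(mδ))`
   (`PadPer.sum_mul_character_padInvariants`), and Pieri's rule for `𝔖`-characters
   (`sum_sum_spechtCharacter_permCongr_sumCongr_mul`, `SymmetricGroupPieriRule.lean`) turns
   `∑_τ χ^π χ_X` into `(nδ)!/(mδ)! · ∑_{π ↦ π'} ∑_σ χ^{π'}(σ) χ_{X_per}(σ)`.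
4. **Prop. 5.5.2** — `∑_σ χ^{π'}(σ) χ_{X_per}(σ) = (mδ)! · perOrbitCeiling(π') = (mδ)! · mult_{π'}`
   (`perOrbitCeiling_eq_multPer`, val-lit t08; corrected `mult`), and `= 0` for `ℓ(π') > m²`
   (Schur–Weyl, `sum_spechtCharacter_mul_character_perStabInvariants_eq_zero`).
Hence `mult_{π*} ≤ ∑_{π ↦ π', ℓ(π') ≤ m²} mult_{π'} ≤ mult^n_π` — `BLMW2011_prop_5_6_2_closure_holds`.

Honest framing: classical representation-theoretic bookkeeping of a printed GCT example (the
padded permanent's orbit, BLMW §5.6); VP ≠ VNP is NOT proved and nothing here bears on it. No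
definitions, no named facts (net debt −1).

## References

* [BurgisserEtAl2011] §5.6 (5.6.1), Def. 5.6.1, Prop. 5.6.2 (5.6.2); Prop. 5.5.2; Prop. 4.5.4; §4.1
  (4.1.2); §5.2 (the method). arXiv v2 pp. 11–12.
* [Macdonald1995] Ch. I (5.16) (Pieri).
* [FultonHarrisGTM129] Thm. 6.3, Lemma 6.22, (2.9).

## Tree

`PadPer.*` (`BLMW11PaddedPerSlice`); `sum_sum_spechtCharacter_permCongr_sumCongr_mul`
(`SymmetricGroupPieriRule`); `perOrbitCeiling`, `perOrbitCeiling_eq_multPer`, `perStabInvariants`,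
`perStabInvariantsPermRep`, `linSubstRep_reindexGL_paddedPerFormLex_of_isPerStab`, `paddedPerFormLex_self`,
`linSubst_kronecker_diagonal_perPoly` (`BLMW11PerOrbitCeiling`, `BLMW11PerSliceCharacterProofs`);
`finrank_highestWeightSpace_orbitCoordRep_le`, `card_mul_finrank_boundSpace`, `size_toMatIdx_dualOfPartition`,
`toMatIdx_comp_matIdxEquiv`, `reindexGL`, `coe_reindexGL` (`SchurWeylPlethysmKroneckerBoundProofs`);
`character_transposedPermRep_dualOfPartition`; `extendGL`, `linSubst_extendMatrix_rename`, `topEmb`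
(`OrbitClosureInheritance`); `isotypicProj_wordPermRep_eq_zero_of_lt`, `trace_isotypicProj`, `classInner_apply`;
`BLMW2011.multPerPadded`, `BLMW2011_prop_5_6_2_closure` (`BLMW11StabilityInheritance`).
-/

noncomputable section

open scoped BigOperators Kronecker
open MvPolynomial Finset

namespace Literature.Computability.AlgebraicComplexity

open _root_.Literature.NumberTheory.DiophantineGeometry
open _root_.Literature.RepresentationTheory.GeneralLinear
open _root_.Literature.RepresentationTheory.FiniteGroups
open PadPer

/-! ### §1 The padded permanent as `x₀₀^{n-m} · ι(per_m)` -/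

section Polynomial

variable (k : Type*) [Field k] {m n : ℕ}

/-- The permanent polynomial is natural under relabelling of the index type:
`rename (β × β) per_ι = per_{ι'}` for a bijection `β : ι ≃ ι'`. [folklore] -/
private theorem rename_prodCongr_perPoly_equiv {ι ι' : Type*} [Fintype ι] [DecidableEq ι] [Fintype ι']
    [DecidableEq ι'] (β : ι ≃ ι') :
    rename (Equiv.prodCongr β β) (perPoly ι k) = perPoly ι' k := by
  unfold perPoly
  simp only [Matrix.permanent, map_sum, map_prod, Matrix.mvPolynomialX_apply, rename_X,
    Equiv.prodCongr_apply, Prod.map_apply]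
  rw [← Equiv.sum_comp (Equiv.permCongr β)]
  refine Finset.sum_congr rfl fun σ _ => ?_
  rw [← Equiv.prod_comp β]
  refine Finset.prod_congr rfl fun i _ => ?_
  simp [Equiv.permCongr_apply]

/-- The block embedding of matrix positions `Mat_{m×m} → Mat_{n×n}`, `(i,j) ↦ (n-m+i, n-m+j)`, on the
lexicographic letters. [cite: BurgisserEtAl2011, §5.6] -/
private theorem blockLetter_eq (hmn : m ≤ n) (x : Fin (m * m)) :
    blockLetter hmn x = (matIdxEquiv n).symm
      ((fun z : MatIdx m => (toLex (topEmb hmn (ofLex z).1, topEmb hmn (ofLex z).2) : MatIdx n))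
        (matIdxEquiv m x)) :=
  rfl

/-- The block map on `MatIdx` is injective. [folklore] -/
private theorem blockIdx_injective (hmn : m ≤ n) :
    Function.Injective (fun z : MatIdx m => (toLex (topEmb hmn (ofLex z).1, topEmb hmn (ofLex z).2) : MatIdx n)) := by
  intro z z' h
  have h' := toLex.injective h
  rw [Prod.mk.injEq] at h'
  rw [← toLex_ofLex z, ← toLex_ofLex z']
  exact congrArg toLex (Prod.ext ((topEmb_strictMono hmn).injective h'.1)
    ((topEmb_strictMono hmn).injective h'.2))

/-- For `m < n` the padding position `x₀₀` is not in the block. [folklore] -/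
private theorem toLex_zero_not_mem_range [NeZero n] (hmn : m < n) :
    (toLex ((0 : Fin n), (0 : Fin n)) : MatIdx n) ∉
      Set.range (fun z : MatIdx m => (toLex (topEmb hmn.le (ofLex z).1, topEmb hmn.le (ofLex z).2) : MatIdx n)) := by
  rintro ⟨z, hz⟩
  have h := congrArg (fun w => ((ofLex w).1 : ℕ)) hz
  simp only [ofLex_toLex, topEmb_val, Fin.val_zero] at h
  omega

/-- **`x₀₀^{n-m} per_m = x₀₀^{n-m} · ι(per_m)`** in the lexicographic matrix letters: the tree's
`paddedPerFormLex k m n` is the `(n-m)`-th power of the padding letter times the permanent of the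
`m × m` matrix letters (`paddedPerFormLex k m m`) renamed along the block embedding. BLMW §5.6:
`x = ℓ^{n-m} per_m ∈ S^n(A ⊕ A')`. [cite: BurgisserEtAl2011, §5.6] -/
theorem paddedPerFormLex_eq_X_pow_mul_rename [NeZero m] [NeZero n] (hmn : m ≤ n) :
    paddedPerFormLex k m n = X (toLex ((0 : Fin n), (0 : Fin n))) ^ (n - m) *
      rename (fun z : MatIdx m => (toLex (topEmb hmn (ofLex z).1, topEmb hmn (ofLex z).2) : MatIdx n))
        (paddedPerFormLex k m m) := by
  -- the bijection `Fin m ≃ BlockIdx m n`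
  let β : Fin m ≃ BlockIdx m n :=
    (Equiv.ofInjective _ (topEmb_strictMono hmn).injective).trans
      (Equiv.subtypeEquivRight fun x => mem_range_topEmb_iff hmn x)
  -- `(β i : Fin n) = topEmb hmn i` definitionally, so the two renamings agree by `rfl`
  rw [paddedPerFormLex, paddedPerPoly, map_mul, map_pow, rename_X, paddedPerFormLex_self,
    ← rename_prodCongr_perPoly_equiv k β, rename_rename, rename_rename, rename_rename]
  congr 2

end Polynomial

/-! ### §2 The family stabilizes `x₀₀^{n-m} per_m` ((5.6.1)) -/

section Stabilizer

variable (k : Type*) [Field k] [CharZero k] {m n : ℕ}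

/-- `(matIdxEquiv n)⁻¹ p` is a block letter iff `p` is in the block (on `MatIdx n`). [folklore] -/
private theorem symm_mem_range_blockLetter_iff (hmn : m ≤ n) (p : MatIdx n) :
    (matIdxEquiv n).symm p ∈ Set.range (blockLetter hmn) ↔
      p ∈ Set.range (fun z : MatIdx m => (toLex (topEmb hmn (ofLex z).1, topEmb hmn (ofLex z).2) : MatIdx n)) := by
  constructor
  · rintro ⟨x, hx⟩
    refine ⟨matIdxEquiv m x, ?_⟩
    rw [blockLetter_eq] at hx
    exact (matIdxEquiv n).symm.injective (by rw [hx])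
  · rintro ⟨z, rfl⟩
    refine ⟨(matIdxEquiv m).symm z, ?_⟩
    rw [blockLetter_eq, OrderIso.apply_symm_apply]

omit [CharZero k] in
/-- **Reindexing the block-diagonal extension**: along `matIdxEquiv`, the extension of `h ∈ GL_{m²}`
by the identity (block letters `blockLetter`) is the extension of `reindexGL (matIdxEquiv m) h` along
the block embedding of `MatIdx m` into `MatIdx n`. [folklore] -/
private theorem coe_reindexGL_extendGL_blockLetter (hmn : m ≤ n) (h : GL (Fin (m * m)) k) :
    ((reindexGL (k := k) (matIdxEquiv n) (extendGL k (blockLetter_injective hmn) h) : GL (MatIdx n) k) :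
        Matrix (MatIdx n) (MatIdx n) k) =
      extendMatrix (blockIdx_injective hmn)
        ((reindexGL (k := k) (matIdxEquiv m) h : GL (MatIdx m) k) : Matrix (MatIdx m) (MatIdx m) k) := by
  ext p q
  rw [coe_reindexGL, Matrix.submatrix_apply, coe_extendGL, coe_reindexGL]
  by_cases hp : p ∈ Set.range (fun z : MatIdx m =>
      (toLex (topEmb hmn (ofLex z).1, topEmb hmn (ofLex z).2) : MatIdx n))
  · obtain ⟨z, rfl⟩ := hp
    have hpz : (matIdxEquiv n).symm (toLex (topEmb hmn (ofLex z).1, topEmb hmn (ofLex z).2)) =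
        blockLetter hmn ((matIdxEquiv m).symm z) := by
      rw [blockLetter_eq, OrderIso.apply_symm_apply]
    by_cases hq : q ∈ Set.range (fun z : MatIdx m =>
        (toLex (topEmb hmn (ofLex z).1, topEmb hmn (ofLex z).2) : MatIdx n))
    · obtain ⟨z', rfl⟩ := hq
      have hqz : (matIdxEquiv n).symm (toLex (topEmb hmn (ofLex z').1, topEmb hmn (ofLex z').2)) =
          blockLetter hmn ((matIdxEquiv m).symm z') := by
        rw [blockLetter_eq, OrderIso.apply_symm_apply]
      rw [hpz, hqz, extendMatrix_app_app, extendMatrix_app_app, Matrix.submatrix_apply]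
    · have hq' : (matIdxEquiv n).symm q ∉ Set.range (blockLetter hmn) :=
        fun h' => hq ((symm_mem_range_blockLetter_iff hmn q).mp h')
      rw [hpz, extendMatrix_app_of_not_mem _ _ _ hq', extendMatrix_app_of_not_mem _ _ _ hq]
  · have hp' : (matIdxEquiv n).symm p ∉ Set.range (blockLetter hmn) :=
      fun h' => hp ((symm_mem_range_blockLetter_iff hmn p).mp h')
    rw [extendMatrix_of_not_mem _ _ hp', extendMatrix_of_not_mem _ _ hp]
    simp only [EmbeddingLike.apply_eq_iff_eq]

omit [CharZero k] in
/-- A block-diagonal extension fixes the variables off the block. [folklore] -/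
private theorem linSubst_extendMatrix_X_of_not_mem {σ τ : Type*} [Fintype σ] [LinearOrder σ] [Fintype τ]
    [LinearOrder τ] {ι : σ → τ} (hι : Function.Injective ι) (c : Matrix σ σ k) {x : τ}
    (hx : x ∉ Set.range ι) : linSubst τ k (extendMatrix hι c) (X x) = X x := by
  rw [linSubst_X]
  have hterm : ∀ j : τ, extendMatrix hι c j x • (X j : MvPolynomial τ k) = if j = x then X x else 0 := by
    intro j
    by_cases hj : j ∈ Set.range ι
    · obtain ⟨i, rfl⟩ := hj
      rw [extendMatrix_app_of_not_mem _ _ _ hx, zero_smul, if_neg]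
      rintro rfl
      exact hx ⟨i, rfl⟩
    · rw [extendMatrix_of_not_mem _ _ hj]
      by_cases hjx : j = x
      · rw [if_pos hjx, if_pos hjx, one_smul, hjx]
      · rw [if_neg hjx, if_neg hjx, zero_smul]
  simp_rw [hterm]
  rw [Finset.sum_ite_eq' Finset.univ x, if_pos (Finset.mem_univ x)]

omit [CharZero k] in
/-- A diagonal substitution scales each variable. [folklore] -/
private theorem linSubst_diagonal_X' {σ : Type*} [Fintype σ] [DecidableEq σ] (d : σ → k) (i : σ) :
    linSubst σ k (Matrix.diagonal d) (X i) = d i • X i := by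
  rw [linSubst_X, Finset.sum_eq_single i]
  · rw [Matrix.diagonal_apply_eq]
  · intro j _ hji
    rw [Matrix.diagonal_apply_ne _ hji, zero_smul]
  · intro h
    exact absurd (Finset.mem_univ i) h

omit [CharZero k] in
/-- A diagonal substitution commutes with renaming: `diag(d) · ι(p) = ι(diag(d ∘ ι) · p)`. [folklore] -/
private theorem linSubst_diagonal_rename {σ τ : Type*} [Fintype σ] [DecidableEq σ] [Fintype τ]
    [DecidableEq τ] (ι : σ → τ) (d : τ → k) (p : MvPolynomial σ k) :
    linSubst τ k (Matrix.diagonal d) (rename ι p) = rename ι (linSubst σ k (Matrix.diagonal (d ∘ ι)) p) := by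
  suffices h : (linSubst τ k (Matrix.diagonal d)).comp (rename ι) =
      (rename ι).comp (linSubst σ k (Matrix.diagonal (d ∘ ι))) from congrArg (fun φ => φ p) h
  apply MvPolynomial.algHom_ext
  intro i
  simp only [AlgHom.comp_apply, rename_X, linSubst_diagonal_X', map_smul, Function.comp_apply]

omit [CharZero k] in
/-- A constant diagonal substitution scales `per_m` by `c^m` (homogeneity; via
`(diag c ⊗ diag 1) · per = (∏ c)(∏ 1) per`, Minc Thm. 1.1(a)). [cite: BurgisserEtAl2011, §5.5 (5.5.1)] -/
private theorem linSubst_diagonal_const_paddedPerFormLex_self [NeZero m] (c : k) :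
    linSubst (MatIdx m) k (Matrix.diagonal fun _ => c) (paddedPerFormLex k m m) =
      c ^ m • paddedPerFormLex k m m := by
  rw [paddedPerFormLex_self, linSubst_diagonal_rename]
  have hdiag : (Matrix.diagonal ((fun _ : MatIdx m => c) ∘ (toLex : Fin m × Fin m → MatIdx m)) :
      Matrix (Fin m × Fin m) (Fin m × Fin m) k) =
      Matrix.diagonal (fun _ : Fin m => c) ⊗ₖ Matrix.diagonal (fun _ : Fin m => (1 : k)) := by
    rw [Matrix.diagonal_kronecker_diagonal]
    congr 1
    funext ij
    simp
  rw [hdiag, linSubst_kronecker_diagonal_perPoly, map_smul]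
  congr 1
  rw [Finset.prod_const, Finset.prod_const_one, mul_one, Finset.card_univ, Fintype.card_fin]

omit [CharZero k] in
/-- **A diagonal element of `GL(W)` that is constant `c` on the block `A` and `c'` on the padding letter
scales `x₀₀^{n-m} per_m` by `c'^{n-m} c^m`** (weights of `S^n(A ⊕ A')`; (5.6.1): `(ξ, η)` acts by
`η^{n-m} ξ^m`). [cite: BurgisserEtAl2011, §5.6 (5.6.1)] -/
private theorem linSubst_diagonal_paddedPerFormLex [NeZero m] [NeZero n] (hmn : m ≤ n)
    (d : MatIdx n → k) (c c' : k)
    (hblock : ∀ z : MatIdx m, d (toLex (topEmb hmn (ofLex z).1, topEmb hmn (ofLex z).2)) = c)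
    (hpad : d (toLex ((0 : Fin n), (0 : Fin n))) = c') :
    linSubst (MatIdx n) k (Matrix.diagonal d) (paddedPerFormLex k m n) =
      (c' ^ (n - m) * c ^ m) • paddedPerFormLex k m n := by
  rw [paddedPerFormLex_eq_X_pow_mul_rename k hmn, map_mul, map_pow, linSubst_diagonal_X', hpad,
    linSubst_diagonal_rename]
  have hd : (d ∘ fun z : MatIdx m => (toLex (topEmb hmn (ofLex z).1, topEmb hmn (ofLex z).2) : MatIdx n)) =
      fun _ => c := funext hblock
  rw [hd, linSubst_diagonal_const_paddedPerFormLex_self, map_smul, smul_pow, smul_mul_smul_comm]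

omit [CharZero k] in
/-- The matrix of `balanceGL` / `killGL` (unfolding). [folklore] -/
private theorem coe_mkOfDetNeZero' {N : ℕ} (d : Fin N → k) (hd : (Matrix.diagonal d).det ≠ 0) :
    ((Matrix.GeneralLinearGroup.mkOfDetNeZero _ hd : GL (Fin N) k) : Matrix (Fin N) (Fin N) k) =
      Matrix.diagonal d :=
  rfl

/-- `(matIdxEquiv n)⁻¹` of a block position is the corresponding block letter. [folklore] -/
private theorem symm_toLex_topEmb (hmn : m ≤ n) (z : MatIdx m) :
    (matIdxEquiv n).symm (toLex (topEmb hmn (ofLex z).1, topEmb hmn (ofLex z).2)) =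
      blockLetter hmn ((matIdxEquiv m).symm z) := by
  rw [blockLetter_eq, OrderIso.apply_symm_apply]

/-- **(5.6.1): every element of the padded family fixes `x₀₀^{n-m} per_m`** (in the lexicographic matrix
letters, reindexed along `matIdxEquiv n`): the extended per-family acts on `ι(per_m)` as the per-family
and fixes `x₀₀`; the balance torus scales by `(2^{-m})^{n-m} (2^{n-m})^m = 1`; the kill torus by `1`.
[cite: BurgisserEtAl2011, §5.6 (5.6.1)] -/
theorem linSubstRep_reindexGL_paddedPerFormLex_of_isPadPerStab [NeZero m] [NeZero n] (hmn : m < n)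
    {g : GL (Fin (n * n)) k} (hg : IsPadPerStab k hmn g) :
    linSubstRep (MatIdx n) k (reindexGL (k := k) (matIdxEquiv n) g) (paddedPerFormLex k m n) =
      paddedPerFormLex k m n := by
  rcases hg with ⟨h, hh, rfl⟩ | rfl | rfl
  · -- the extended per-family
    rw [linSubstRep_apply, coe_reindexGL_extendGL_blockLetter k hmn.le h,
      paddedPerFormLex_eq_X_pow_mul_rename k hmn.le, map_mul, map_pow,
      linSubst_extendMatrix_X_of_not_mem k _ _ (toLex_zero_not_mem_range hmn),
      linSubst_extendMatrix_rename, ← linSubstRep_apply,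
      linSubstRep_reindexGL_paddedPerFormLex_of_isPerStab k m hh]
  · -- the balance torus
    rw [linSubstRep_apply, coe_reindexGL, balanceGL, coe_mkOfDetNeZero']
    rw [show (Matrix.diagonal (balanceDiag k hmn.le)).submatrix ⇑(matIdxEquiv n).symm ⇑(matIdxEquiv n).symm =
        Matrix.diagonal (balanceDiag k hmn.le ∘ ⇑(matIdxEquiv n).symm) from
      Matrix.submatrix_diagonal_equiv (balanceDiag k hmn.le) (matIdxEquiv n).symm.toEquiv]
    rw [linSubst_diagonal_paddedPerFormLex k hmn.le _ ((2 : k) ^ (n - m)) (((2 : k) ^ m)⁻¹)]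
    · rw [inv_pow, ← pow_mul, ← pow_mul, mul_comm m (n - m), inv_mul_cancel₀ (pow_ne_zero _ two_ne_zero),
        one_smul]
    · intro z
      rw [Function.comp_apply, symm_toLex_topEmb]
      unfold balanceDiag
      rw [if_pos ⟨_, rfl⟩]
    · rw [Function.comp_apply]
      change balanceDiag k hmn.le (padLetter n) = _
      unfold balanceDiag
      rw [if_neg (padLetter_not_mem_range hmn), if_pos rfl]
  · -- the kill torus
    rw [linSubstRep_apply, coe_reindexGL, killGL, coe_mkOfDetNeZero']
    rw [show (Matrix.diagonal (killDiag k hmn.le)).submatrix ⇑(matIdxEquiv n).symm ⇑(matIdxEquiv n).symm =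
        Matrix.diagonal (killDiag k hmn.le ∘ ⇑(matIdxEquiv n).symm) from
      Matrix.submatrix_diagonal_equiv (killDiag k hmn.le) (matIdxEquiv n).symm.toEquiv]
    rw [linSubst_diagonal_paddedPerFormLex k hmn.le _ (1 : k) (1 : k)]
    · rw [one_pow, one_pow, mul_one, one_smul]
    · intro z
      rw [Function.comp_apply, symm_toLex_topEmb]
      unfold killDiag
      rw [if_pos (Or.inl ⟨_, rfl⟩)]
    · rw [Function.comp_apply]
      change killDiag k hmn.le (padLetter n) = _
      unfold killDiag
      rw [if_pos (Or.inr rfl)]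

end Stabilizer

/-! ### §3 The bound `mult_{π*} ≤ dim T(padInvariants)` and its character count -/

section Bound

variable {m n δ : ℕ}

/-- **`mult_{π*} ℂ[Δ_n(x₀₀^{n-m} per_m)] ≤ dim boundSpace π* (padInvariants)`** (characteristic zero;
`ℓ(π) ≤ n²`): the tree's `finrank_highestWeightSpace_orbitCoordRep_le` (BLMW §5.2 / (4.1.2):
`mult_π ℂ[\overline{GL·x}] ≤ dim (S_πW)^H` for a subgroup `H` of the stabilizer) with the padded family.
[cite: BurgisserEtAl2011, Prop. 5.6.2 (5.6.2)] -/
theorem orbitMultiplicity_paddedPer_le_finrank_boundSpace [NeZero n] (hm : 0 < m) (hmn : m < n)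
    (π : Nat.Partition (n * δ)) (hπ : π.parts.card ≤ n * n) :
    orbitMultiplicity ℂ (paddedPerFormLex ℂ m n) n (Weight.dualOfPartition (n * n) π).toMatIdx ≤
      Module.finrank ℂ (boundSpace ℂ (Weight.dualOfPartition (n * n) π) (padInvariants ℂ hmn (n * δ))) := by
  haveI : NeZero m := ⟨hm.ne'⟩
  have hle := finrank_highestWeightSpace_orbitCoordRep_le (paddedPerFormLex ℂ m n) n
    ((Weight.dualOfPartition (n * n) π).toMatIdx : Weight (MatIdx n)) (matIdxEquiv n)
    (size_toMatIdx_dualOfPartition n π hπ) (padInvariants ℂ hmn (n * δ)) (IsPadPerStab ℂ hmn)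
    (fun _ hx => hx)
    (fun g hg => linSubstRep_reindexGL_paddedPerFormLex_of_isPadPerStab ℂ hmn hg)
  rw [toMatIdx_comp_matIdxEquiv] at hle
  exact hle

/-- **`(nδ)! · dim T = ∑_τ χ^π(τ) χ_X(τ)`**, `X = padInvariants` (`card_mul_finrank_boundSpace`,
`χ_Y = χ^π`). [cite: FultonHarrisGTM129, §2.2 (2.9)] -/
theorem factorial_mul_finrank_boundSpace_padInvariants [NeZero n] (hmn : m < n)
    (π : Nat.Partition (n * δ)) (hπ : π.parts.card ≤ n * n) :
    (((n * δ).factorial : ℕ) : ℂ) *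
        (Module.finrank ℂ (boundSpace ℂ (Weight.dualOfPartition (n * n) π) (padInvariants ℂ hmn (n * δ))) : ℂ) =
      ∑ τ : Equiv.Perm (Fin (n * δ)), spechtCharacter ℂ π τ *
        ((wordPermRep ℂ (n * n) (n * δ)).subrepresentation (padInvariants ℂ hmn (n * δ))
          (padInvariants_le_comap ℂ hmn)).character τ := by
  have h := card_mul_finrank_boundSpace ℂ (Weight.dualOfPartition (n * n) π)
    (padInvariants ℂ hmn (n * δ)) (padInvariants_le_comap ℂ hmn)
  rw [Fintype.card_perm, Fintype.card_fin, character_transposedPermRep_dualOfPartition ℂ π hπ] at h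
  exact h

/-- **`(mδ)! · perOrbitCeiling π' = ∑_σ χ^{π'}(σ) χ_{X_per}(σ)`** (`ℓ(π') ≤ m²`; as in
`two_mul_factorial_mul_perOrbitCeiling`). [cite: BurgisserEtAl2011, Prop. 5.5.2 (proof)] -/
theorem factorial_mul_perOrbitCeiling_eq_sum (π' : Nat.Partition (m * δ)) (hπ' : π'.parts.card ≤ m * m) :
    (((m * δ).factorial : ℕ) : ℂ) * (perOrbitCeiling ℂ m δ π' : ℂ) =
      ∑ σ : Equiv.Perm (Fin (m * δ)), spechtCharacter ℂ π' σ *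
        (perStabInvariantsPermRep ℂ m (D := m * δ)).character σ := by
  have h := card_mul_finrank_boundSpace ℂ (Weight.dualOfPartition (m * m) π')
    (perStabInvariants ℂ m (m * δ)) (perStabInvariants_le_comap ℂ m)
  rw [Fintype.card_perm, Fintype.card_fin, character_transposedPermRep_dualOfPartition ℂ π' hπ'] at h
  exact h

/-- **No `[π']` with more than `m²` rows occurs in `X_per ⊆ (ℂ^{m²})^{⊗mδ}`**:
`∑_σ χ^{π'}(σ) χ_{X_per}(σ) = 0` for `ℓ(π') > m²` (Schur–Weyl, `S_{π'}(ℂ^{m²}) = 0`; the isotypic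
projector of `[π']` vanishes on all functions of words, `isotypicProj_wordPermRep_eq_zero_of_lt`).
[cite: FultonHarrisGTM129, Thm. 6.3 (1)] -/
theorem sum_spechtCharacter_mul_character_perStabInvariants_eq_zero {D : ℕ} (μ : Nat.Partition D)
    (hμ : m * m < μ.parts.card) :
    ∑ τ : Equiv.Perm (Fin D), spechtCharacter ℂ μ τ *
        (perStabInvariantsPermRep ℂ m (D := D)).character τ = 0 := by
  set ρ₀ := perStabInvariantsPermRep ℂ m (D := D) with hρ₀
  have hP : isotypicProj ρ₀ (spechtCharacter ℂ μ) = 0 := by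
    apply LinearMap.ext
    intro v
    apply Subtype.ext
    have h0 := LinearMap.congr_fun (isotypicProj_wordPermRep_eq_zero_of_lt (n := D) hμ)
      (v : Word (m * m) D → ℂ)
    rw [isotypicProj_apply, LinearMap.zero_apply] at h0
    rw [LinearMap.zero_apply, isotypicProj_apply, Submodule.coe_zero, ← h0, Submodule.coe_sum]
    refine Finset.sum_congr rfl fun t _ => ?_
    rw [Submodule.coe_smul, hρ₀, perStabInvariantsPermRep, Representation.subrepresentation_apply,
      LinearMap.coe_restrict_apply]
  have htr := trace_isotypicProj ρ₀ (spechtCharacter ℂ μ)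
  rw [hP, map_zero] at htr
  have hci : classInner (spechtCharacter ℂ μ) ρ₀.character = 0 :=
    (mul_eq_zero.mp htr.symm).resolve_left (spechtCharacter_one_ne_zero' μ)
  rw [classInner_apply] at hci
  have hsum := (mul_eq_zero.mp hci).resolve_left
    (inv_ne_zero (Nat.cast_ne_zero.mpr Fintype.card_ne_zero))
  rw [← hsum]
  refine Fintype.sum_equiv (Equiv.inv _) _ _ fun s => ?_
  rw [Equiv.inv_apply, inv_inv,
    _root_.Literature.RepresentationTheory.FiniteGroups.spechtCharacter_inv]

end Bound

/-! ### §4 Assembly: `BLMW2011_prop_5_6_2_closure_holds` -/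

section Assembly

open Classical in
/-- **The padded invariant count** (`3 ≤ m < n`, `0 < δ`, `ℓ(π) ≤ n²`): with `a = mδ`, `b = (n-m)δ`,
`(nδ)! · dim T = C(nδ, b) · b! · (mδ)! · ∑_{π' ⊢ mδ, π ↦ π', ℓ(π') ≤ m²} mult_{π'}` — steps 2–4 of the
module docstring: the character of `padInvariants` (`PadPer.sum_mul_character_padInvariants`), Pieri's
rule for `𝔖`-characters, and `(mδ)! · perOrbitCeiling = (mδ)! · mult_{π'}` (`perOrbitCeiling_eq_multPer`).
[cite: BurgisserEtAl2011, Prop. 5.6.2 (5.6.2)] -/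
theorem factorial_mul_finrank_boundSpace_padInvariants_eq {m n δ : ℕ} [NeZero n] (hm : 3 ≤ m)
    (hmn : m < n) (hδ : 0 < δ) (π : Nat.Partition (n * δ)) (hπ : π.parts.card ≤ n * n) :
    (n * δ).factorial *
        Module.finrank ℂ (boundSpace ℂ (Weight.dualOfPartition (n * n) π) (padInvariants ℂ hmn (n * δ))) =
      (n * δ).choose ((n - m) * δ) * ((n - m) * δ).factorial * (m * δ).factorial *
        ∑ π' ∈ (univ : Finset (Nat.Partition (m * δ))).filter
          (fun π' => (∀ i : ℕ, π'.sortedParts.getD i 0 ≤ π.sortedParts.getD i 0 ∧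
            π.sortedParts.getD (i + 1) 0 ≤ π'.sortedParts.getD i 0) ∧ π'.parts.card ≤ m * m),
          BLMW2011.multPer ℂ m δ π' := by
  haveI : NeZero m := ⟨by omega⟩
  have hab : m * δ + (n - m) * δ = n * δ := by
    rw [← add_mul, Nat.add_sub_cancel' hmn.le]
  have hbal : (n - m) * (m * δ) = m * ((n - m) * δ) := by ring
  apply Nat.cast_injective (R := ℂ)
  push_cast
  rw [factorial_mul_finrank_boundSpace_padInvariants hmn π hπ,
    sum_mul_character_padInvariants hmn hab hbal (spechtCharacter ℂ π)]
  -- Pieri on each pattern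
  have hS : ∀ S : {S : Finset (Fin (n * δ)) // S.card = (n - m) * δ},
      ∑ σ : Equiv.Perm (Fin (m * δ)), ∑ ρ : Equiv.Perm (Fin ((n - m) * δ)),
          spechtCharacter ℂ π ((splitEquiv hab S.1 S.2).permCongr (σ.sumCongr ρ)) *
            (perStabInvariantsPermRep ℂ m (D := m * δ)).character σ =
        (((n - m) * δ).factorial : ℂ) * ∑ π' ∈ (univ : Finset (Nat.Partition (m * δ))).filter
          (fun π' => ∀ i : ℕ, π'.sortedParts.getD i 0 ≤ π.sortedParts.getD i 0 ∧
            π.sortedParts.getD (i + 1) 0 ≤ π'.sortedParts.getD i 0),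
          ∑ σ : Equiv.Perm (Fin (m * δ)), spechtCharacter ℂ π' σ *
            (perStabInvariantsPermRep ℂ m (D := m * δ)).character σ := fun S =>
    sum_sum_spechtCharacter_permCongr_sumCongr_mul (splitEquiv hab S.1 S.2) π _
  simp_rw [hS]
  rw [Finset.sum_const, Finset.card_univ, card_patterns, nsmul_eq_mul]
  -- the inner sums: `(mδ)! mult_{π'}` or `0`
  have hT : ∀ π' : Nat.Partition (m * δ),
      ∑ σ : Equiv.Perm (Fin (m * δ)), spechtCharacter ℂ π' σ *
          (perStabInvariantsPermRep ℂ m (D := m * δ)).character σ =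
        if π'.parts.card ≤ m * m then (((m * δ).factorial : ℕ) : ℂ) * (BLMW2011.multPer ℂ m δ π' : ℂ)
        else 0 := by
    intro π'
    by_cases h : π'.parts.card ≤ m * m
    · rw [if_pos h, ← perOrbitCeiling_eq_multPer hδ π' h, factorial_mul_perOrbitCeiling_eq_sum π' h]
    · rw [if_neg h]
      exact sum_spechtCharacter_mul_character_perStabInvariants_eq_zero π' (not_le.mp h)
  simp_rw [hT]
  rw [Finset.sum_ite, Finset.sum_const_zero, add_zero, Finset.filter_filter, ← Finset.mul_sum]
  ring

open Classical in
/-- **BLMW 2011, Prop. 5.6.2, (5.6.2) — the named fact `BLMW2011_prop_5_6_2_closure`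
(`BLMW11StabilityInheritance.lean`) DISCHARGED** in its as-proved reading (corrected `mult_{π'}`,
`0 < δ`): for `3 ≤ m < n`, `0 < δ`, `π ⊢ nδ` with `ℓ(π) ≤ n²`, the multiplicity of `π*` in
`ℂ[Δ_n(x₀₀^{n-m} per_m)]` is at most `mult^n_π = ∑_{π ↦ π'} mult_{π'}`. Proof: module docstring
((5.6.1) stabilizer family ⇒ bound space ⇒ character of `⊕_S E_S X_per` ⇒ Pieri ⇒ Prop. 5.5.2),
dropping the vanishing summands `ℓ(π') > m²` and dividing by `(nδ)! = C(nδ,(n-m)δ) ((n-m)δ)! (mδ)!`.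
[cite: BurgisserEtAl2011, Prop. 5.6.2 (5.6.2)] -/
theorem BLMW2011_prop_5_6_2_closure_holds : BLMW2011_prop_5_6_2_closure := by
  intro m n δ _ π hm hmn hδ hπ
  have hbound := orbitMultiplicity_paddedPer_le_finrank_boundSpace (by omega) hmn π hπ
  refine hbound.trans ?_
  have heq := factorial_mul_finrank_boundSpace_padInvariants_eq hm hmn hδ π hπ
  -- `C(nδ, b) · b! · (mδ)! = (nδ)!`
  have hchoose : (n * δ).choose ((n - m) * δ) * ((n - m) * δ).factorial * (m * δ).factorial =
      (n * δ).factorial := by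
    have hle : (n - m) * δ ≤ n * δ := Nat.mul_le_mul_right _ (Nat.sub_le n m)
    have hsub : n * δ - (n - m) * δ = m * δ := by
      rw [← Nat.sub_mul]
      congr 1
      omega
    have := Nat.choose_mul_factorial_mul_factorial hle
    rw [hsub] at this
    exact this
  rw [hchoose] at heq
  have hpos : 0 < (n * δ).factorial := Nat.factorial_pos _
  apply Nat.le_of_mul_le_mul_left _ hpos
  rw [heq]
  apply Nat.mul_le_mul_left
  -- drop the summands with `ℓ(π') > m²` (they are not needed; all summands are `≥ 0`)
  unfold BLMW2011.multPerPadded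
  refine Finset.sum_le_sum_of_subset_of_nonneg ?_ (fun _ _ _ => Nat.zero_le _)
  intro π' hπ'
  rw [Finset.mem_filter] at hπ' ⊢
  exact ⟨hπ'.1, hπ'.2.1⟩

end Assembly

end Literature.Computability.AlgebraicComplexity

end
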